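/-
Copyright (c) 2026 the pub-hodgecm-mathlib formalisation cell (harness21).  Prover seat hodgecm-mathlib-K2E4-p11 (g7): Track B «K2-LIT»,
#184♮ = hLiu418 = stmt-HodgeConjecture-24832; socket #41 open surface (u-0c) — file I4, EDITION 3 as a LETTER-PAYER file: the identification letter `hMID` of
★ `exists_middleTerm_package` ∕ ★ `exists_middleTerm_package'` PAID from ★ α3-2, ★ I2, ★ (H), ★ `measurePreserving_conj_levi` and ★ `middle_eq_tsum_untwisted`
(LEAD F0P6-plan (g14) BATCH #51 (1): «discharges as they ★»).  THEOREMS ONLY (no `def`, no `instance`, no `notation`, no named-fact hypothesis, no `sorry`).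
-/
import Summits.HodgeConjecture.HodgeConjecture.Theorems.K2LiuSiegelIwasawaLeviInnerSection          -- ★ I2 part 3 p861819 `inner_section_levi_mul_eq` (+ ★ α3-2 `middle_cell_eq_tsum`)
import Summits.HodgeConjecture.HodgeConjecture.Theorems.K2LiuSiegelEisensteinConstantTermFiniteness -- ★ (H) `lintegral_tsum_enorm_mul_weight_ne_top`
import Summits.HodgeConjecture.HodgeConjecture.Theorems.K2LiuUnipDeltaConjMeasurePreserving         -- ★ `measurePreserving_conj_levi`
import Summits.HodgeConjecture.HodgeConjecture.Theorems.K2LiuMiddleCellPackageOfFaces               -- ★ (β0-4) `middle_eq_tsum_untwisted`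
import Literature.NumberTheory.Automorphic.IdeleClassGroup                                          -- ★ `ideleNorm_principal` (product formula)
import HarnessLib

/-!
# Crux `HLiu418`, socket #41, (u-0c) FILE I4 ED. 3 — `K2LiuSiegelMiddleTermIdentification`: THE IDENTIFICATION LETTER `hMID` OF THE MIDDLE-CELL PACKAGE,
# `∫ β(u) • Σ'_{q ∈ REST} f_s(γ_q·(u·h)) dνN(u) = 1 · Σ'_{p ∈ ℙ¹(L)} φ s h (γ̂_p · m(h))` for the untwisted inner family, PAID at `n = 2`

Cell `hodgecm-mathlib`, crux item hLiu418 = `stmt-HodgeConjecture-24832`; squad K2 ∕ K2Liu, road `K2_Liu`, socket #41; LEAD F0P6-plan (g14) BATCH #51 (1), desk K2E5-p17 (g8).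
Lane `--supports stmt-HodgeConjecture-24832 --as helper` (count-neutral helper; closes no socket by itself).  FRAME: `e : Fin N × Fin M ≃ Fin 2` LITERAL (the currency of
every `hMID` payer — ★ α3-2, ★ I1, ★ I2 part 3, ★ C-part); the I4 head (general `n`, `hn : n = 2`) absorbs this letter once its datum letters reach END-CONDITION (c)'s currency.

THE MATHEMATICS [MoeglinWaldspurger1995, II.1.7], [KudlaRallis1994, §2 (2.10)–(2.12)], [CogdellAnalyticTheory2004, §2.3], [BorelJacquet1979, §4.1].  For `n = 2` the middle
cell of the constant term of the Siegel Eisenstein series along `N_Δ`, `MID_s(h) = ∫ β(u) • Σ'_{q ∈ REST} f_s(γ_q·(u·h)) dνN(u)`, is the `GL₂` Borel Eisenstein sum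
`Σ'_{p ∈ ℙ¹(L)} F_s(Λ(γ̂_p)·h)` of the inner section `F_s(x) = ∫ β₁(u) • f_s(w₀·(u·x)) dνN(u)` (★ α3-2 `middle_cell_eq_tsum`, whose two analytic letters are PAID here:
the `L¹` letter (H) by ★ `lintegral_tsum_enorm_mul_weight_ne_top` — `χ` unitary, `1 < re s`, `∫⁻β < ∞`, `β ≤ 𝟙_K`, `K` compact — and the conjugation invariance
`hconj` of the Haar measure `νN` by ★ `measurePreserving_conj_levi`); in the Iwasawa coordinates `h = u'·Λ(m(h))·k(h)` of `H(𝔸)` along `P_Δ` (★ I2 part 1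
`exists_iwasawaLeviCoordinate`) each term rewrites as `F_s(Λ(γ̂_p·m(h))·k(h))` (★ I2 part 3 `inner_section_levi_mul_eq`) — §1 `middleTerm_eq_tsum_levi` (= the letter
`hMIDF` of ★ (β0-4) `middle_eq_tsum_untwisted`); and for a character `ξ` of the ideles trivial on `det GL₂(L)` (§2 `xi_det_map_eq_one`: `ξ = χ·|·|^{½}` with `χ` a Hecke
character and the product formula ★ `ideleNorm_principal`) the UNTWISTED family `φ s x g = ξ(det g)⁻¹ · ξ(det m(x)) · F_s(Λ g · k(x))` satisfies
**`MID_s(h) = 1 · Σ'_p φ s h (γ̂_p · m(h))`** on `1 < re s` (★ `middle_eq_tsum_untwisted`) — §3 `middleTerm_eq_tsum_untwisted`, LITERALLY the binder `hMID` of ★ I4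
`exists_middleTerm_package` ∕ ★ ED. 2 `exists_middleTerm_package'` at `n = 2`, `c₀ = 1` (its companions `hφT`, `hφN` are ★ I1 `innerFamily_torus_law` ∕
`innerFamily_unipotent_law` for the same by-value `φ hφ a ha b kx ξ`).  Visible letters: α3-2's datum `g₀ hg₀ Λ hΛ Γ₀ hΓ₀ wq hwq β₁ hβ₁ F hF`, the carrier letters
`νN` (Haar) `β hβ hβtop K hK hβK`, the section letters `χ hχ f hf hfc`, I2's coordinates `mx kx hp hmx` BY VALUE, the row section `γ hγ` (★ `exists_rowSection₂`, row
currency) and `ξ a b φ` BY VALUE with their defining equations.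
HONEST LABEL.  Count-neutral helper; it retires nothing by itself: `HC_CM` is proved only modulo the 7 printed citations (2 remaining named inputs:
hLiu418 = `stmt-HodgeConjecture-24832`, h413 = `stmt-HodgeConjecture-24833`) until rung 0 closes.

## References
* [MoeglinWaldspurger1995] C. Mœglin, J.-L. Waldspurger, *Spectral decomposition and Eisenstein series* (1995), II.1.7.
* [KudlaRallis1994] S. Kudla, S. Rallis, *A regularized Siegel–Weil formula: the first term identity*, Ann. of Math. 140 (1994), §2 (2.10)–(2.12).
* [CogdellAnalyticTheory2004] J. Cogdell, *Lectures on L-functions, converse theorems, and functoriality for GL_n* (2004), §2.3.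
* [BorelJacquet1979] A. Borel, H. Jacquet, *Automorphic forms and automorphic representations*, Corvallis I (1979), §4.1.
* [TateThesis1967] J. Tate, *Fourier analysis in number fields and Hecke's zeta-functions* (1967), §4.3 (product formula, Hecke characters).
-/

set_option autoImplicit false
set_option linter.dupNamespace false -- the mandated namespace repeats `HodgeConjecture.HodgeConjecture`

noncomputable section

open scoped Matrix ENNReal NNReal
open NumberField IsDedekindDomain MeasureTheory MeasureTheory.Measure Filter Set Function
open Literature.NumberTheory.Automorphic Literature.NumberTheory.Automorphic.UnitaryGroup Literature.NumberTheory.GaloisRepresentations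
open Literature.NumberTheory.GelbartRogawski1991 Literature.NumberTheory.GelbartRogawski1991.GRConstruction
open Literature.NumberTheory.GelbartRogawski1991.AdaptedBlocks
open Literature.NumberTheory.K2Lit.SiegelDoubled Literature.MeasureTheory.Group
open UnitaryDualPair
open Summit.HodgeConjecture.HodgeConjecture.Cruxes.HLiu418.K2LiuUnipotentCoveringWeight
open Summit.HodgeConjecture.HodgeConjecture.Cruxes.HLiu418.K2LiuSiegelMiddleCellLeviCriterion (row_ne_zero)
open Summit.HodgeConjecture.HodgeConjecture.Cruxes.HLiu418.K2LiuSiegelRationalLeviDecomposition (conj_levi_mem_unipDelta)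
open Summit.HodgeConjecture.HodgeConjecture.Cruxes.HLiu418.K2LiuConstantTermMiddleCellGL2 (middle_cell_eq_tsum)
open Summit.HodgeConjecture.HodgeConjecture.Cruxes.HLiu418.K2LiuSiegelIwasawaLeviInnerSection (inner_section_levi_mul_eq)
open Summit.HodgeConjecture.HodgeConjecture.Cruxes.HLiu418.K2LiuSiegelEisensteinConstantTermFiniteness (lintegral_tsum_enorm_mul_weight_ne_top)
open Summit.HodgeConjecture.HodgeConjecture.Cruxes.HLiu418.K2LiuUnipDeltaConjMeasurePreserving (measurePreserving_conj_levi)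
open Summit.HodgeConjecture.HodgeConjecture.Cruxes.HLiu418.K2LiuMiddleCellPackageOfFaces (middle_eq_tsum_untwisted)

namespace Summit.HodgeConjecture.HodgeConjecture.Cruxes.HLiu418.K2LiuSiegelMiddleTermIdentification

variable {L : Type} [Field L] [NumberField L] [IsCMField L]

/-! ## §2 (stated first, no frame) The untwisting character is trivial on `det GL₂(L)` -/

omit [IsCMField L] in
/-- **`ξ(det γ̂₀) = 1` for `γ₀ ∈ GL₂(L)`** when `ξ = χ·|·|^{½}` (as complex numbers) for a Hecke character `χ`: `det γ̂₀ = (det γ₀)^` is a principal idele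
(`Matrix.GeneralLinearGroup.map_det`), on which `χ` is trivial (★ `HeckeCharacter.map_principal`) and `|·|_𝔸 = 1` (product formula ★ `ideleNorm_principal`) — the binder `hξL`
of ★ (β0-4) `middle_eq_tsum_untwisted`. [cite: TateThesis1967, §4.3] [cite: MoeglinWaldspurger1995, II.1.7] -/
theorem xi_det_map_eq_one (χ : HeckeCharacter L) (ξ : (AdeleRing (𝓞 L) L)ˣ →* ℂˣ)
    (hξ : ∀ d : (AdeleRing (𝓞 L) L)ˣ, ((ξ d : ℂˣ) : ℂ) = ((χ d : ℂˣ) : ℂ) * ((IdeleClassGroup.ideleNorm L d : ℝ) : ℂ) ^ (1 / 2 : ℂ)) (γ₀ : GL (Fin 2) L) :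
    ξ (Matrix.GeneralLinearGroup.det (Matrix.GeneralLinearGroup.map (algebraMap L (AdeleRing (𝓞 L) L)) γ₀)) = 1 := by
  have hmem : Matrix.GeneralLinearGroup.det (Matrix.GeneralLinearGroup.map (algebraMap L (AdeleRing (𝓞 L) L)) γ₀) ∈ principalIdeles L :=
    ⟨Matrix.GeneralLinearGroup.det γ₀, (Matrix.GeneralLinearGroup.map_det _ γ₀).symm⟩
  refine Units.val_eq_one.1 ?_
  rw [hξ, χ.map_principal hmem, ideleNorm_principal hmem, Units.val_one, NNReal.coe_one, Complex.ofReal_one, Complex.one_cpow, one_mul]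

/-! ## The `n = 2` datum (★ α3-2's variable block VERBATIM) -/

section Two

variable {N M : ℕ} {e : Fin N × Fin M ≃ Fin 2}
  {dV : Fin N → L} {hdV : ∀ i, IsCMField.complexConj L (dV i) = dV i}
  {dW : Fin M → L} {hdW : ∀ i, IsCMField.complexConj L (dW i) = dW i}
variable [MeasurableSpace (unipDelta L e dV hdV dW hdW)] [BorelSpace (unipDelta L e dV hdV dW hdW)]

variable {g₀ : UnitaryGroup.rationalPair (Fp L) L (IsCMField.complexConj L) N M (Matrix.diagonal dV) (Matrix.diagonal dW)}
  (hg₀ : ((g₀ : GL (Fin N × Fin M) L) : Matrix (Fin N × Fin M) (Fin N × Fin M) L) = Matrix.diagonal (fun k => 1 - 2 * (![0, 1] : Fin 2 → L) (e k)))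
  (Λ : GL (Fin 2) (AdeleRing (𝓞 L) L) →* HA L e dV hdV dW hdW)
  (hΛ : ∀ g : GL (Fin 2) (AdeleRing (𝓞 L) L), blk L e dV hdV dW hdW (Λ g) =
    cayR (AdeleRing (𝓞 L) L) (Fin 2) * Matrix.fromBlocks (g : Matrix (Fin 2) (Fin 2) (AdeleRing (𝓞 L) L)) 0 0
      (((gramR L e dV hdV dW hdW).map ((algebraMap L (AdeleRing (𝓞 L) L)).comp (algebraMap (Fp L) L)))⁻¹ *
        (((g⁻¹ : GL (Fin 2) (AdeleRing (𝓞 L) L)) : Matrix (Fin 2) (Fin 2) (AdeleRing (𝓞 L) L)).map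
          (conjAdele (Fp L) L (IsCMField.complexConj L)))ᵀ *
        (gramR L e dV hdV dW hdW).map ((algebraMap L (AdeleRing (𝓞 L) L)).comp (algebraMap (Fp L) L))) *
      cayRinv (AdeleRing (𝓞 L) L) (Fin 2))
  (Γ₀ : Subgroup (unipDelta L e dV hdV dW hdW))
  (hΓ₀ : ∀ u : unipDelta L e dV hdV dW hdW, u ∈ Γ₀ ↔ (u : HA L e dV hdV dW hdW) ∈ ratH L e dV hdV dW hdW ∧
    IsSiegelDelta L e dV hdV dW hdW (iotaGG L e dV hdV dW hdW (1, UnitaryGroup.rationalPairToAdelic (Fp L) L (IsCMField.complexConj L) N M (Matrix.diagonal dV) (Matrix.diagonal dW) g₀) * (u : HA L e dV hdV dW hdW) * (iotaGG L e dV hdV dW hdW (1, UnitaryGroup.rationalPairToAdelic (Fp L) L (IsCMField.complexConj L) N M (Matrix.diagonal dV) (Matrix.diagonal dW) g₀))⁻¹))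
  (wq : unipDeltaRat L e dV hdV dW hdW → ratH L e dV hdV dW hdW)
  (hwq : ∀ ν, ((wq ν : ratH L e dV hdV dW hdW) : HA L e dV hdV dW hdW) =
    weylDelta L e dV hdV dW hdW * ((ν : unipDelta L e dV hdV dW hdW) : HA L e dV hdV dW hdW))

/-! ## §1 `hMIDF`: the middle term in the Iwasawa–Levi coordinates, (H) and `hconj` paid -/

include hwq hg₀ hΛ hΓ₀ in
/-- **`hMIDF` AT FIXED `s`, THE ANALYTIC LETTERS OF ★ α3-2 PAID.**  `νN` a Haar measure on `N_Δ(𝔸)`, `β` an `N_Δ(L⁺)`-covering weight with `∫⁻β < ∞` and `β ≤ 𝟙_K` (`K` compact),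
`χ` unitary, `1 < re s`, `f ∈ I_Δ(s, χ)` continuous, `β₁` a `Γ₀ = Stab([w₀])`-weight, `F(x) = ∫ β₁(u) • f(w₀·(u·x)) dνN(u)`, `γ` a row section (`[(γ p)₁] = p`), and ANY `k` with
`h·k⁻¹ ∈ P_Δ(𝔸)` of `Δ`-block `m`:  **`∫ β(u) • Σ'_{q ∈ REST} f(γ_q·(u·h)) dνN(u) = Σ'_{p ∈ ℙ¹(L)} F(Λ(γ̂_p · m) · k)`** — ★ α3-2 `middle_cell_eq_tsum` with (H) := ★
`lintegral_tsum_enorm_mul_weight_ne_top` and `hconj` := ★ `measurePreserving_conj_levi`, then `tsum_congr` ★ I2 part 3 `inner_section_levi_mul_eq`.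
[cite: MoeglinWaldspurger1995, II.1.7] [cite: KudlaRallis1994, §2 (2.10)–(2.12)] [cite: BorelJacquet1979, §4.1] -/
theorem middleTerm_eq_tsum_levi (hdV0 : ∀ i, dV i ≠ 0) (hdW0 : ∀ i, dW i ≠ 0) (νN : Measure (unipDelta L e dV hdV dW hdW)) [νN.IsHaarMeasure]
    {β : unipDelta L e dV hdV dW hdW → ℝ≥0∞} (hβ : IsCoveringWeight (unipDeltaRat L e dV hdV dW hdW) β) (hβtop : ∫⁻ u, β u ∂νN ≠ ∞)
    {K : Set (unipDelta L e dV hdV dW hdW)} (hK : IsCompact K) (hβK : ∀ u, β u ≤ K.indicator 1 u)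
    {χ : HeckeCharacter L} (hχ : χ.IsUnitary) {s : ℂ} (hs : 1 < s.re) {f : HA L e dV hdV dW hdW → ℂ} (hf : IsSiegelDeltaSection L e dV hdV dW hdW χ s f) (hfc : Continuous f)
    {β₁ : unipDelta L e dV hdV dW hdW → ℝ≥0∞} (hβ₁ : IsCoveringWeight Γ₀ β₁)
    (F : HA L e dV hdV dW hdW → ℂ)
    (hF : ∀ x, F x = ∫ u, (β₁ u).toReal • f (iotaGG L e dV hdV dW hdW (1, UnitaryGroup.rationalPairToAdelic (Fp L) L (IsCMField.complexConj L) N M (Matrix.diagonal dV) (Matrix.diagonal dW) g₀) * ((u : HA L e dV hdV dW hdW) * x)) ∂νN)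
    (γ : Projectivization L (Fin 2 → L) → GL (Fin 2) L)
    (hγ : ∀ p, Projectivization.mk L ((γ p : Matrix (Fin 2) (Fin 2) L) 1) (row_ne_zero (γ p) 1) = p)
    (h k : HA L e dV hdV dW hdW) (hp : IsSiegelDelta L e dV hdV dW hdW (h * k⁻¹))
    {m : GL (Fin 2) (AdeleRing (𝓞 L) L)} (hm : (m : Matrix (Fin 2) (Fin 2) (AdeleRing (𝓞 L) L)) = deltaBlock L e dV hdV dW hdW (h * k⁻¹)) :
    ∫ u, (β u).toReal •
        (∑' q : ↥(({Quotient.mk (MulAction.orbitRel (siegelDeltaRat L e dV hdV dW hdW) (ratH L e dV hdV dW hdW)) 1} ∪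
            Set.range (fun ν : unipDeltaRat L e dV hdV dW hdW =>
              (Quotient.mk (MulAction.orbitRel (siegelDeltaRat L e dV hdV dW hdW) (ratH L e dV hdV dW hdW)) (wq ν) :
                SiegelDeltaQuot L e dV hdV dW hdW)))ᶜ : Set (SiegelDeltaQuot L e dV hdV dW hdW)),
          f ((((Quotient.out (q : SiegelDeltaQuot L e dV hdV dW hdW) : ratH L e dV hdV dW hdW) : HA L e dV hdV dW hdW)) *
            ((u : HA L e dV hdV dW hdW) * h))) ∂νN =
      ∑' p : Projectivization L (Fin 2 → L), F (Λ (Matrix.GeneralLinearGroup.map (algebraMap L (AdeleRing (𝓞 L) L)) (γ p) * m) * k) := by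
  -- (H) at `h`: `n ∕ 2 = 1 < re s`
  have hs' : ((2 : ℕ) : ℝ) / 2 < s.re := by rw [Nat.cast_ofNat]; linarith
  have hH := lintegral_tsum_enorm_mul_weight_ne_top L e dV hdV dW hdW hdV0 hdW0 hχ hs' hf hfc νN hβtop hK hβK h
  -- `hconj` for the Haar measure `νN`
  have hconj := fun g : GL (Fin 2) L => measurePreserving_conj_levi Λ hΛ hdV0 hdW0 νN g
  rw [(middle_cell_eq_tsum hg₀ Λ hΛ Γ₀ hΓ₀ wq hwq hdV0 hdW0 νN hβ hf hfc h hH hβ₁ hconj F hF γ hγ).1]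
  exact tsum_congr fun p => inner_section_levi_mul_eq Λ hΛ Γ₀ hΓ₀ hdV0 hdW0 νN hβ hf hfc h k hp hm hH hβ₁ (γ p) (hconj (γ p)) F hF

/-! ## §3 THE LETTER `hMID` (`c₀ = 1`) for the untwisted inner family -/

include hwq hg₀ hΛ hΓ₀ in
/-- **(u-0c) I4, ED. 3 — THE IDENTIFICATION LETTER `hMID` PAID (`n = 2`, `c₀ = 1`).**  Same carrier ∕ section letters for a family `f_s ∈ I_Δ(s, χ)` of continuous sections and the
inner sections `F_s(x) = ∫ β₁(u) • f_s(w₀·(u·x)) dνN(u)`; Iwasawa–Levi coordinates `mx kx` BY VALUE with ★ I2 part 1's `hp : h·(kx h)⁻¹ ∈ P_Δ(𝔸)` and `hmx : mx h = (h·(kx h)⁻¹)|_Δ`;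
a row section `γ` (row currency, ★ `exists_rowSection₂`); a character `ξ` of the ideles with `ξ(det γ̂₀) = 1` on `GL₂(L)` (§2); and the UNTWISTED family BY VALUE,
`φ s x g = a g · b x · F_s(Λ g · kx x)`, `a g = ξ(det g)⁻¹`, `b x = ξ(det (mx x))`:
  **`∀ s h, 1 < re s → ∫ β(u) • Σ'_{q ∈ REST} f_s(γ_q·(u·h)) dνN(u) = 1 · Σ'_{p ∈ ℙ¹(L)} φ s h (γ̂_p · mx h)`** — the binder `hMID` of ★ `exists_middleTerm_package` ∕
★ `exists_middleTerm_package'` at `n = 2` (`(n:ℝ)∕2 < re s` ⟺ `1 < re s`), `c₀ = 1` (§1 + ★ `middle_eq_tsum_untwisted`).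
[cite: MoeglinWaldspurger1995, II.1.7] [cite: KudlaRallis1994, §2 (2.10)–(2.12)] [cite: CogdellAnalyticTheory2004, §2.3] -/
theorem middleTerm_eq_tsum_untwisted (hdV0 : ∀ i, dV i ≠ 0) (hdW0 : ∀ i, dW i ≠ 0) (νN : Measure (unipDelta L e dV hdV dW hdW)) [νN.IsHaarMeasure]
    {β : unipDelta L e dV hdV dW hdW → ℝ≥0∞} (hβ : IsCoveringWeight (unipDeltaRat L e dV hdV dW hdW) β) (hβtop : ∫⁻ u, β u ∂νN ≠ ∞)
    {K : Set (unipDelta L e dV hdV dW hdW)} (hK : IsCompact K) (hβK : ∀ u, β u ≤ K.indicator 1 u)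
    {χ : HeckeCharacter L} (hχ : χ.IsUnitary) (f : ℂ → HA L e dV hdV dW hdW → ℂ) (hf : ∀ s : ℂ, IsSiegelDeltaSection L e dV hdV dW hdW χ s (f s)) (hfc : ∀ s : ℂ, Continuous (f s))
    {β₁ : unipDelta L e dV hdV dW hdW → ℝ≥0∞} (hβ₁ : IsCoveringWeight Γ₀ β₁)
    (F : ℂ → HA L e dV hdV dW hdW → ℂ)
    (hF : ∀ (s : ℂ) (x : HA L e dV hdV dW hdW), F s x = ∫ u, (β₁ u).toReal • f s (iotaGG L e dV hdV dW hdW (1, UnitaryGroup.rationalPairToAdelic (Fp L) L (IsCMField.complexConj L) N M (Matrix.diagonal dV) (Matrix.diagonal dW) g₀) * ((u : HA L e dV hdV dW hdW) * x)) ∂νN)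
    (γ : Projectivization L (Fin 2 → L) → GL (Fin 2) L)
    (hγ : ∀ p, Projectivization.mk L ((γ p : Matrix (Fin 2) (Fin 2) L) 1) (row_ne_zero (γ p) 1) = p)
    (mx : HA L e dV hdV dW hdW → GL (Fin 2) (AdeleRing (𝓞 L) L)) (kx : HA L e dV hdV dW hdW → HA L e dV hdV dW hdW)
    (hp : ∀ h, IsSiegelDelta L e dV hdV dW hdW (h * (kx h)⁻¹))
    (hmx : ∀ h, ((mx h : GL (Fin 2) (AdeleRing (𝓞 L) L)) : Matrix (Fin 2) (Fin 2) (AdeleRing (𝓞 L) L)) = deltaBlock L e dV hdV dW hdW (h * (kx h)⁻¹))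
    (ξ : (AdeleRing (𝓞 L) L)ˣ →* ℂˣ) (hξL : ∀ γ₀ : GL (Fin 2) L, ξ (Matrix.GeneralLinearGroup.det (Matrix.GeneralLinearGroup.map (algebraMap L (AdeleRing (𝓞 L) L)) γ₀)) = 1)
    (a : GL (Fin 2) (AdeleRing (𝓞 L) L) → ℂ) (ha : ∀ g, a g = (((ξ (Matrix.GeneralLinearGroup.det g))⁻¹ : ℂˣ) : ℂ))
    (b : HA L e dV hdV dW hdW → ℂ) (hb : ∀ x, b x = ((ξ (Matrix.GeneralLinearGroup.det (mx x)) : ℂˣ) : ℂ))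
    (φ : ℂ → HA L e dV hdV dW hdW → GL (Fin 2) (AdeleRing (𝓞 L) L) → ℂ) (hφ : ∀ s x g, φ s x g = a g * b x * F s (Λ g * kx x)) :
    ∀ (s : ℂ) (h : HA L e dV hdV dW hdW), 1 < s.re →
      (∫ u, (β u).toReal •
        (∑' q : ↥(({Quotient.mk (MulAction.orbitRel (siegelDeltaRat L e dV hdV dW hdW) (ratH L e dV hdV dW hdW)) 1} ∪
            Set.range (fun ν : unipDeltaRat L e dV hdV dW hdW =>
              (Quotient.mk (MulAction.orbitRel (siegelDeltaRat L e dV hdV dW hdW) (ratH L e dV hdV dW hdW)) (wq ν) :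
                SiegelDeltaQuot L e dV hdV dW hdW)))ᶜ : Set (SiegelDeltaQuot L e dV hdV dW hdW)),
          f s ((((Quotient.out (q : SiegelDeltaQuot L e dV hdV dW hdW) : ratH L e dV hdV dW hdW) : HA L e dV hdV dW hdW)) *
            ((u : HA L e dV hdV dW hdW) * h))) ∂νN) =
        1 * ∑' p : Projectivization L (Fin 2 → L), φ s h (Matrix.GeneralLinearGroup.map (algebraMap L (AdeleRing (𝓞 L) L)) (γ p) * mx h) := by
  intro s h hs
  refine middle_eq_tsum_untwisted Λ ξ hξL F kx mx γ
    (fun s h => ∫ u, (β u).toReal •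
        (∑' q : ↥(({Quotient.mk (MulAction.orbitRel (siegelDeltaRat L e dV hdV dW hdW) (ratH L e dV hdV dW hdW)) 1} ∪
            Set.range (fun ν : unipDeltaRat L e dV hdV dW hdW =>
              (Quotient.mk (MulAction.orbitRel (siegelDeltaRat L e dV hdV dW hdW) (ratH L e dV hdV dW hdW)) (wq ν) :
                SiegelDeltaQuot L e dV hdV dW hdW)))ᶜ : Set (SiegelDeltaQuot L e dV hdV dW hdW)),
          f s ((((Quotient.out (q : SiegelDeltaQuot L e dV hdV dW hdW) : ratH L e dV hdV dW hdW) : HA L e dV hdV dW hdW)) *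
            ((u : HA L e dV hdV dW hdW) * h))) ∂νN)
    (c := 1) (fun s x hs => ?_) φ (fun s x g => by rw [hφ, ha, hb]) s h hs
  exact middleTerm_eq_tsum_levi hg₀ Λ hΛ Γ₀ hΓ₀ wq hwq hdV0 hdW0 νN hβ hβtop hK hβK hχ hs (hf s) (hfc s) hβ₁ (F s) (hF s) γ hγ x (kx x) (hp x) (hmx x)

end Two

end Summit.HodgeConjecture.HodgeConjecture.Cruxes.HLiu418.K2LiuSiegelMiddleTermIdentification

end
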